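import Mathlib

/-!
# Crux `PolyMobiusTail` (stmt-Parity-0870), line `Sketch` (natural form): helper lemmas for the stub
# `stub_signedTypeI_of_kernel`

Generic bookkeeping used by the proof of `stub_signedTypeI_of_kernel` (file
`IsogenyRedeiPolyMobiusTailStubSignedTypeIOfKernel.lean`):

* `periodic_weight_range`, `stub_periodic_weight_Icc` (registered stub `stub_periodic_weight_Icc` of the lead's skeleton, so that this helper file lands under the gate's stub-match rule) — a monotone non-negative weight summed against a
  `D`-periodic sequence `c` with values in `[0, 1]` is `(ρ/D) ·` the plain weighted sum up to an error
  `≤ 4ρ · (largest weight)`, `ρ = Σ_{j<D} c j` (block argument, no equidistribution input);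
* `exists_monotone_eval` — an integer polynomial with positive degree and positive leading coefficient
  is eventually non-decreasing along `ℕ`;
* `sum_box_div_prod_le` — the hyperbolic box count `Σ_{1 ≤ dᵢ ≤ y} y/∏ dᵢ ≤ y (1 + log y)^k`;
* `core_estimate`, `box_error_sum_le` — swapping the `n`- and `d`-sums and collecting the periodic errors;
* `isLittleO_model` — `B + C·x/log x + C'·(log x)^m x^θ = o(x)` for `θ < 1`.
-/

open scoped BigOperators
open Filter Finset Asymptotics Polynomial

namespace Summit.Parity.BatemanHorn.Theorems.PolyMobiusTail.NaturalForm.SignedTypeIAux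

/-! ### Periodic sequences against monotone weights -/

/-- A `D`-periodic sequence is invariant under shifts by multiples of `D`. [folklore] -/
theorem periodic_shift {c : ℕ → ℝ} {D : ℕ} (hc : ∀ n, c (n + D) = c n) (q j : ℕ) :
    c (q * D + j) = c j := by
  induction q with
  | zero => simp
  | succ q ih =>
    have h : (q + 1) * D + j = (q * D + j) + D := by ring
    rw [h, hc, ih]

/-- One full period of a monotone weight against a centred sequence `e` (`Σ_{j<D} e j = 0`):
`|Σ_{j<D} g(QD+j) e(j)| ≤ (g((Q+1)D) - g(QD)) Σ_j |e j|`. [folklore] -/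
theorem block_sum_le (g e : ℕ → ℝ) (hg : Monotone g) (D Q : ℕ) (he : ∑ j ∈ range D, e j = 0) :
    |∑ j ∈ range D, g (Q * D + j) * e j|
      ≤ (g (Q * D + D) - g (Q * D)) * ∑ j ∈ range D, |e j| := by
  have h1 : ∑ j ∈ range D, g (Q * D + j) * e j
      = ∑ j ∈ range D, (g (Q * D + j) - g (Q * D)) * e j := by
    have h : ∑ j ∈ range D, (g (Q * D + j) - g (Q * D)) * e j
        = ∑ j ∈ range D, g (Q * D + j) * e j - g (Q * D) * ∑ j ∈ range D, e j := by
      rw [Finset.mul_sum, ← Finset.sum_sub_distrib]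
      exact Finset.sum_congr rfl fun j _ => by ring
    rw [h, he, mul_zero, sub_zero]
  rw [h1, Finset.mul_sum]
  refine (Finset.abs_sum_le_sum_abs _ _).trans (Finset.sum_le_sum fun j hj => ?_)
  have hj' : j < D := mem_range.mp hj
  rw [abs_mul]
  refine mul_le_mul_of_nonneg_right ?_ (abs_nonneg _)
  rw [abs_of_nonneg (sub_nonneg.mpr (hg (Nat.le_add_right _ _)))]
  exact sub_le_sub_right (hg (by omega)) _

/-- Full periods: `|Σ_{n<QD} g(n) e(n)| ≤ (g(QD) - g 0) Σ_{j<D} |e j|` for a monotone weight `g` and a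
centred `D`-periodic `e`. [folklore] -/
theorem full_blocks_le (g e : ℕ → ℝ) (hg : Monotone g) {D : ℕ} (he0 : ∑ j ∈ range D, e j = 0)
    (hper : ∀ n, e (n + D) = e n) (Q : ℕ) :
    |∑ n ∈ range (Q * D), g n * e n| ≤ (g (Q * D) - g 0) * ∑ j ∈ range D, |e j| := by
  induction Q with
  | zero => simp
  | succ Q ih =>
    rw [Nat.succ_mul, Finset.sum_range_add]
    have h2 : ∑ x ∈ range D, g (Q * D + x) * e (Q * D + x)
        = ∑ x ∈ range D, g (Q * D + x) * e x :=
      Finset.sum_congr rfl fun x _ => by rw [periodic_shift hper]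
    rw [h2]
    calc |∑ n ∈ range (Q * D), g n * e n + ∑ x ∈ range D, g (Q * D + x) * e x|
        ≤ |∑ n ∈ range (Q * D), g n * e n| + |∑ x ∈ range D, g (Q * D + x) * e x| := abs_add_le _ _
      _ ≤ (g (Q * D) - g 0) * ∑ j ∈ range D, |e j|
          + (g (Q * D + D) - g (Q * D)) * ∑ j ∈ range D, |e j| :=
          add_le_add ih (block_sum_le g e hg D Q he0)
      _ = (g (Q * D + D) - g 0) * ∑ j ∈ range D, |e j| := by ring

/-- **Monotone weight against a periodic sequence (range form).** For `g` monotone with `0 ≤ g 0`,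
`c` `D`-periodic with values in `[0, 1]` and `ρ = Σ_{j<D} c j`:
`|Σ_{n<M} g(n) c(n) - (ρ/D) Σ_{n<M} g(n)| ≤ 4 ρ g(M)`. [folklore] -/
theorem periodic_weight_range (g c : ℕ → ℝ) (hg : Monotone g) (hg0 : 0 ≤ g 0) {D : ℕ} (hD : 0 < D)
    (hc : ∀ n, c (n + D) = c n) (hc0 : ∀ n, 0 ≤ c n) (M : ℕ) :
    |∑ n ∈ range M, g n * c n - (∑ j ∈ range D, c j) / D * ∑ n ∈ range M, g n|
      ≤ 4 * (∑ j ∈ range D, c j) * g M := by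
  set ρ : ℝ := ∑ j ∈ range D, c j with hρ
  set e : ℕ → ℝ := fun n => c n - ρ / D with he
  have hDR : (0 : ℝ) < D := by exact_mod_cast hD
  have hρ0 : 0 ≤ ρ := Finset.sum_nonneg fun j _ => hc0 j
  have hρD : 0 ≤ ρ / D := div_nonneg hρ0 hDR.le
  have hgnn : ∀ n, 0 ≤ g n := fun n => hg0.trans (hg (Nat.zero_le n))
  have he0 : ∑ j ∈ range D, e j = 0 := by
    simp only [he, Finset.sum_sub_distrib, Finset.sum_const, card_range, nsmul_eq_mul]
    rw [← hρ, mul_div_assoc', mul_div_cancel_left₀ _ hDR.ne', sub_self]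
  have hper : ∀ n, e (n + D) = e n := fun n => by simp only [he, hc]
  have heabs : ∑ j ∈ range D, |e j| ≤ 2 * ρ := by
    calc ∑ j ∈ range D, |e j| ≤ ∑ j ∈ range D, (c j + ρ / D) :=
          Finset.sum_le_sum fun j _ => by
            simp only [he]
            exact abs_sub_le_iff.mpr ⟨by linarith [hc0 j], by linarith [hc0 j]⟩
      _ = 2 * ρ := by
          rw [Finset.sum_add_distrib, Finset.sum_const, card_range, nsmul_eq_mul, ← hρ,
            mul_div_assoc', mul_div_cancel_left₀ _ hDR.ne']
          ring
  have hEnn : 0 ≤ ∑ j ∈ range D, |e j| := Finset.sum_nonneg fun j _ => abs_nonneg _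
  obtain ⟨Q, s, hs, rfl⟩ : ∃ Q s, s < D ∧ M = Q * D + s :=
    ⟨M / D, M % D, Nat.mod_lt _ hD, (Nat.div_add_mod' M D).symm⟩
  have hmain : ∑ n ∈ range (Q * D + s), g n * c n - ρ / D * ∑ n ∈ range (Q * D + s), g n
      = ∑ n ∈ range (Q * D + s), g n * e n := by
    rw [Finset.mul_sum, ← Finset.sum_sub_distrib]
    exact Finset.sum_congr rfl fun n _ => by simp only [he]; ring
  rw [hmain, Finset.sum_range_add]
  have hA := full_blocks_le g e hg he0 hper Q
  have hB : |∑ j ∈ range s, g (Q * D + j) * e (Q * D + j)|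
      ≤ g (Q * D + s) * ∑ j ∈ range D, |e j| := by
    calc |∑ j ∈ range s, g (Q * D + j) * e (Q * D + j)|
        ≤ ∑ j ∈ range s, |g (Q * D + j) * e (Q * D + j)| := Finset.abs_sum_le_sum_abs _ _
      _ = ∑ j ∈ range s, g (Q * D + j) * |e j| :=
          Finset.sum_congr rfl fun j _ => by
            rw [abs_mul, periodic_shift hper, abs_of_nonneg (hgnn _)]
      _ ≤ ∑ j ∈ range s, g (Q * D + s) * |e j| :=
          Finset.sum_le_sum fun j hj =>
            mul_le_mul_of_nonneg_right (hg (by have := mem_range.mp hj; omega)) (abs_nonneg _)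
      _ = g (Q * D + s) * ∑ j ∈ range s, |e j| := by rw [Finset.mul_sum]
      _ ≤ g (Q * D + s) * ∑ j ∈ range D, |e j| :=
          mul_le_mul_of_nonneg_left
            (Finset.sum_le_sum_of_subset_of_nonneg (range_subset_range.mpr hs.le)
              fun _ _ _ => abs_nonneg _) (hgnn _)
  have hgM : g (Q * D) - g 0 ≤ g (Q * D + s) := by linarith [hg (Nat.le_add_right (Q * D) s)]
  calc |∑ n ∈ range (Q * D), g n * e n + ∑ j ∈ range s, g (Q * D + j) * e (Q * D + j)|
      ≤ |∑ n ∈ range (Q * D), g n * e n| + |∑ j ∈ range s, g (Q * D + j) * e (Q * D + j)| :=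
        abs_add_le _ _
    _ ≤ (g (Q * D) - g 0) * ∑ j ∈ range D, |e j| + g (Q * D + s) * ∑ j ∈ range D, |e j| :=
        add_le_add hA hB
    _ ≤ g (Q * D + s) * ∑ j ∈ range D, |e j| + g (Q * D + s) * ∑ j ∈ range D, |e j| :=
        add_le_add_left (mul_le_mul_of_nonneg_right hgM hEnn) _
    _ = 2 * g (Q * D + s) * ∑ j ∈ range D, |e j| := by ring
    _ ≤ 2 * g (Q * D + s) * (2 * ρ) :=
        mul_le_mul_of_nonneg_left heabs (by linarith [hgnn (Q * D + s)])
    _ = 4 * ρ * g (Q * D + s) := by ring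

/-- **Stub `stub_periodic_weight_Icc`: monotone weight against a periodic sequence (interval form).** For `W ≥ 0` and non-decreasing on
`[a, ∞)`, `a ≤ b`, `c` `D`-periodic with values `≥ 0` and `ρ = Σ_{j<D} c j`:
`|Σ_{a≤n≤b} W(n) c(n) - (ρ/D) Σ_{a≤n≤b} W(n)| ≤ 4 ρ W(b)`. [folklore] -/
theorem stub_periodic_weight_Icc : ∀ (W c : ℕ → ℝ) (a b : ℕ), a ≤ b → (∀ n, a ≤ n → 0 ≤ W n) →
    (∀ m n, a ≤ m → m ≤ n → W m ≤ W n) → ∀ (D : ℕ), 0 < D → (∀ n, c (n + D) = c n) →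
    (∀ n, 0 ≤ c n) → |∑ n ∈ Finset.Icc a b, W n * c n
      - (∑ j ∈ Finset.range D, c j) / D * ∑ n ∈ Finset.Icc a b, W n|
        ≤ 4 * (∑ j ∈ Finset.range D, c j) * W b := by
  intro W c a b hab hW0 hWmono D hD hc hc0
  set g : ℕ → ℝ := fun n => if a ≤ n then W (min n b) else 0 with hg
  have hgmono : Monotone g := by
    intro m n hmn
    simp only [hg]
    by_cases hm : a ≤ m
    · have hn : a ≤ n := hm.trans hmn
      rw [if_pos hm, if_pos hn]
      exact hWmono _ _ (le_min hm hab) (min_le_min_right b hmn)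
    · rw [if_neg hm]
      split_ifs with hn
      · exact hW0 _ (le_min hn hab)
      · exact le_rfl
  have hg0 : 0 ≤ g 0 := by
    simp only [hg]
    split_ifs with h
    · exact hW0 _ (le_min h hab)
    · exact le_rfl
  have key := periodic_weight_range g c hgmono hg0 hD hc hc0 (b + 1)
  have hgb : g (b + 1) = W b := by
    simp only [hg, if_pos (hab.trans (Nat.le_succ b)), min_eq_right (Nat.le_succ b)]
  have hsum : ∀ F : ℕ → ℝ, ∑ n ∈ range (b + 1), g n * F n = ∑ n ∈ Icc a b, W n * F n := by
    intro F
    have h : ∀ n ∈ range (b + 1), g n * F n = if a ≤ n then W n * F n else 0 := by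
      intro n hn
      have hnb : n ≤ b := Nat.lt_succ_iff.mp (mem_range.mp hn)
      simp only [hg, min_eq_left hnb]
      split_ifs <;> simp
    rw [Finset.sum_congr rfl h, ← Finset.sum_filter]
    congr 1
    ext n
    simp only [mem_filter, mem_range, mem_Icc]
    omega
  have h2 : ∑ n ∈ range (b + 1), g n = ∑ n ∈ Icc a b, W n := by
    simpa using hsum (fun _ => 1)
  rw [hsum c, h2, hgb] at key
  exact key

/-! ### Eventual monotonicity of polynomial values -/

/-- An integer polynomial with positive degree and positive leading coefficient is eventually
non-decreasing along `ℕ`: its real derivative has positive leading coefficient, hence no roots and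
non-negative values beyond some point, and the mean value inequality applies. [folklore] -/
theorem exists_monotone_eval (f : ℤ[X]) (hdeg : 1 ≤ f.natDegree) (hlc : 0 < f.leadingCoeff) :
    ∃ N : ℕ, ∀ m n : ℕ, N ≤ m → m ≤ n → f.eval (m : ℤ) ≤ f.eval (n : ℤ) := by
  set F : ℝ[X] := f.map (Int.castRingHom ℝ) with hF
  have hinj : Function.Injective (Int.castRingHom ℝ) := Int.cast_injective
  have hFdeg : F.natDegree = f.natDegree := natDegree_map_eq_of_injective hinj f
  have hFlc : F.leadingCoeff = (f.leadingCoeff : ℝ) := by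
    rw [hF, leadingCoeff_map_of_injective hinj, eq_intCast]
  set F' : ℝ[X] := derivative F with hF'
  have hF'lc : F'.leadingCoeff = (f.leadingCoeff : ℝ) * f.natDegree := by
    rw [hF', leadingCoeff_derivative, hFlc, hFdeg]
  have hlcpos : (0 : ℝ) < (f.leadingCoeff : ℝ) * f.natDegree :=
    mul_pos (by exact_mod_cast hlc) (by exact_mod_cast hdeg)
  have hF'ne : F' ≠ 0 := by
    intro h
    rw [h, leadingCoeff_zero] at hF'lc
    linarith
  obtain ⟨T, hT⟩ := (F'.roots.toFinset).bddAbove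
  have hpos : ∀ x : ℝ, T ≤ x → 0 ≤ F'.eval x := by
    intro x hx
    refine Polynomial.zero_le_eval_of_roots_le_of_leadingCoeff_nonneg (fun y hy => ?_) ?_
    · have hy' : y ∈ (F'.roots.toFinset : Set ℝ) :=
        Finset.mem_coe.mpr (Multiset.mem_toFinset.mpr ((Polynomial.mem_roots hF'ne).mpr hy))
      exact (hT hy').trans hx
    · rw [hF'lc]
      exact hlcpos.le
  have hmono : MonotoneOn (fun x => F.eval x) (Set.Ici T) := by
    refine monotoneOn_of_deriv_nonneg (convex_Ici T) F.continuousOn F.differentiableOn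
      fun x hx => ?_
    rw [Polynomial.deriv]
    rw [interior_Ici] at hx
    exact hpos x (le_of_lt hx)
  refine ⟨⌈T⌉₊, fun m n hm hmn => ?_⟩
  have hmT : T ≤ (m : ℝ) := (Nat.le_ceil T).trans (by exact_mod_cast hm)
  have hnT : T ≤ (n : ℝ) := hmT.trans (by exact_mod_cast hmn)
  have h := hmono (Set.mem_Ici.mpr hmT) (Set.mem_Ici.mpr hnT) (by exact_mod_cast hmn)
  simp only [hF, eval_natCast_map, eq_intCast] at h
  exact_mod_cast h

/-! ### The hyperbolic box count -/

/-- `Σ_{d ∈ [1,⌊y⌋]^k} y / ∏ dᵢ = y · H_{⌊y⌋}^k ≤ y (1 + log y)^k` for `y ≥ 1`. [folklore] -/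
theorem sum_box_div_prod_le (k : ℕ) {y : ℝ} (hy : 1 ≤ y) :
    ∑ d ∈ Fintype.piFinset (fun _ : Fin k => Icc 1 ⌊y⌋₊), y / ∏ i, (d i : ℝ)
      ≤ y * (1 + Real.log y) ^ k := by
  have h1 : ∀ d : Fin k → ℕ, y / ∏ i, (d i : ℝ) = y * ∏ i, ((d i : ℝ))⁻¹ := fun d => by
    rw [div_eq_mul_inv, Finset.prod_inv_distrib]
  simp_rw [h1]
  rw [← Finset.mul_sum, ← Finset.prod_univ_sum (fun _ => Icc 1 ⌊y⌋₊) (fun _ m => ((m : ℕ) : ℝ)⁻¹),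
    Finset.prod_const, Finset.card_univ, Fintype.card_fin]
  refine mul_le_mul_of_nonneg_left ?_ (by linarith)
  have hH : ∑ m ∈ Icc 1 ⌊y⌋₊, ((m : ℕ) : ℝ)⁻¹ = ((harmonic ⌊y⌋₊ : ℚ) : ℝ) := by
    rw [harmonic_eq_sum_Icc]
    push_cast
    rfl
  rw [hH]
  have hfl : (1 : ℝ) ≤ (⌊y⌋₊ : ℝ) := by exact_mod_cast Nat.le_floor (by exact_mod_cast hy)
  have hH0 : (0 : ℝ) ≤ ((harmonic ⌊y⌋₊ : ℚ) : ℝ) := by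
    rw [← hH]
    exact Finset.sum_nonneg fun m _ => inv_nonneg.mpr (Nat.cast_nonneg m)
  refine pow_le_pow_left₀ hH0 ?_ k
  calc ((harmonic ⌊y⌋₊ : ℚ) : ℝ) ≤ 1 + Real.log ⌊y⌋₊ := harmonic_le_one_add_log _
    _ ≤ 1 + Real.log y :=
        by linarith [Real.log_le_log (by linarith) (Nat.floor_le (by linarith) : (⌊y⌋₊ : ℝ) ≤ y)]

/-- Collecting the periodic errors over the box: if `|w d| ≤ L` on the box and `ρ d ≤ ∏ dᵢ`, then
`Σ_{d ∈ box, ∏ dᵢ ≤ y} |w d| ρ d ≤ L · y · y (1 + log y)^k`. [folklore] -/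
theorem box_error_sum_le {k : ℕ} (w : (Fin k → ℕ) → ℝ) (ρ : (Fin k → ℕ) → ℕ) {y L : ℝ}
    (hy : 1 ≤ y) (hL : 0 ≤ L)
    (hw : ∀ d ∈ Fintype.piFinset (fun _ : Fin k => Icc 1 ⌊y⌋₊), |w d| ≤ L)
    (hρ : ∀ d, ρ d ≤ ∏ i, d i) :
    ∑ d ∈ Fintype.piFinset (fun _ : Fin k => Icc 1 ⌊y⌋₊),
        (if ∏ i, (d i : ℝ) ≤ y then |w d| * (ρ d : ℝ) else 0)
      ≤ L * (y * (y * (1 + Real.log y) ^ k)) := by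
  calc ∑ d ∈ Fintype.piFinset (fun _ : Fin k => Icc 1 ⌊y⌋₊),
        (if ∏ i, (d i : ℝ) ≤ y then |w d| * (ρ d : ℝ) else 0)
      ≤ ∑ d ∈ Fintype.piFinset (fun _ : Fin k => Icc 1 ⌊y⌋₊), L * (y * (y / ∏ i, (d i : ℝ))) := by
        refine Finset.sum_le_sum fun d hd => ?_
        have hd1 : ∀ i, 1 ≤ d i := fun i => (mem_Icc.mp (Fintype.mem_piFinset.mp hd i)).1
        have hP1 : (1 : ℝ) ≤ ∏ i, (d i : ℝ) := by
          rw [← Nat.cast_prod]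
          exact_mod_cast Finset.one_le_prod' fun i _ => hd1 i
        have hP0 : (0 : ℝ) < ∏ i, (d i : ℝ) := by linarith
        split_ifs with hp
        · have hρ' : (ρ d : ℝ) ≤ ∏ i, (d i : ℝ) := by
            rw [← Nat.cast_prod]; exact_mod_cast hρ d
          have h1 : (1 : ℝ) ≤ y / ∏ i, (d i : ℝ) := by rwa [le_div_iff₀ hP0, one_mul]
          calc |w d| * (ρ d : ℝ) ≤ L * y :=
                mul_le_mul (hw d hd) (hρ'.trans hp) (Nat.cast_nonneg _) hL
            _ = L * (y * 1) := by ring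
            _ ≤ L * (y * (y / ∏ i, (d i : ℝ))) := by gcongr
        · positivity
    _ = L * (y * ∑ d ∈ Fintype.piFinset (fun _ : Fin k => Icc 1 ⌊y⌋₊), y / ∏ i, (d i : ℝ)) := by
        rw [Finset.mul_sum, Finset.mul_sum]
    _ ≤ L * (y * (y * (1 + Real.log y) ^ k)) := by
        gcongr
        exact sum_box_div_prod_le k hy

/-! ### Swapping the sums and collecting the periodic errors -/

/-- **Swap and period.** For a weight `W ≥ 0` non-decreasing on `[N₀, ∞)`, coefficients `w d` and a
predicate `P d n` that is `∏ dᵢ`-periodic in `n`, the double sum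
`Σ_{N₀≤n≤x} W(n) Σ_{d ∈ box, ∏dᵢ ≤ y} w(d) [P d n]` equals `(Σ_{N₀≤n≤x} W(n)) · Σ_{d} w(d) ρ_d/∏dᵢ`
(`ρ_d = #{r < ∏ dᵢ : P d r}`) up to `4 W(x) Σ_{d ∈ box, ∏ dᵢ ≤ y} |w d| ρ_d`. [folklore] -/
theorem core_estimate {k : ℕ} (W : ℕ → ℝ) (w : (Fin k → ℕ) → ℝ) (P : (Fin k → ℕ) → ℕ → Prop)
    [∀ d n, Decidable (P d n)] {N₀ x : ℕ} (hN₀x : N₀ ≤ x) (y : ℝ)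
    (hW0 : ∀ n, N₀ ≤ n → 0 ≤ W n) (hWmono : ∀ m n, N₀ ≤ m → m ≤ n → W m ≤ W n)
    (hP : ∀ d n, P d (n + ∏ i, d i) ↔ P d n) :
    |(∑ n ∈ Icc N₀ x, W n * ∑ d ∈ Fintype.piFinset (fun _ : Fin k => Icc 1 ⌊y⌋₊),
        if ∏ i, (d i : ℝ) ≤ y then w d * (if P d n then 1 else 0) else 0)
      - (∑ n ∈ Icc N₀ x, W n) * ∑ d ∈ Fintype.piFinset (fun _ : Fin k => Icc 1 ⌊y⌋₊),
        if ∏ i, (d i : ℝ) ≤ y then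
          w d * ((((range (∏ i, d i)).filter (P d)).card : ℝ) / ∏ i, (d i : ℝ)) else 0|
    ≤ 4 * W x * ∑ d ∈ Fintype.piFinset (fun _ : Fin k => Icc 1 ⌊y⌋₊),
        if ∏ i, (d i : ℝ) ≤ y then |w d| * (((range (∏ i, d i)).filter (P d)).card : ℝ) else 0 := by
  have hswap : (∑ n ∈ Icc N₀ x, W n * ∑ d ∈ Fintype.piFinset (fun _ : Fin k => Icc 1 ⌊y⌋₊),
        if ∏ i, (d i : ℝ) ≤ y then w d * (if P d n then 1 else 0) else 0)
      = ∑ d ∈ Fintype.piFinset (fun _ : Fin k => Icc 1 ⌊y⌋₊), if ∏ i, (d i : ℝ) ≤ y then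
          w d * ∑ n ∈ Icc N₀ x, W n * (if P d n then 1 else 0) else 0 := by
    have h : ∀ n ∈ Icc N₀ x, (W n * ∑ d ∈ Fintype.piFinset (fun _ : Fin k => Icc 1 ⌊y⌋₊),
          if ∏ i, (d i : ℝ) ≤ y then w d * (if P d n then 1 else 0) else 0)
        = ∑ d ∈ Fintype.piFinset (fun _ : Fin k => Icc 1 ⌊y⌋₊),
          if ∏ i, (d i : ℝ) ≤ y then w d * (W n * (if P d n then 1 else 0)) else 0 := by
      intro n _
      rw [Finset.mul_sum]
      refine Finset.sum_congr rfl fun d _ => ?_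
      split_ifs <;> ring
    rw [Finset.sum_congr rfl h, Finset.sum_comm]
    refine Finset.sum_congr rfl fun d _ => ?_
    split_ifs with hp
    · rw [Finset.mul_sum]
    · simp
  rw [hswap, Finset.mul_sum, ← Finset.sum_sub_distrib]
  calc |∑ d ∈ Fintype.piFinset (fun _ : Fin k => Icc 1 ⌊y⌋₊),
        ((if ∏ i, (d i : ℝ) ≤ y then w d * ∑ n ∈ Icc N₀ x, W n * (if P d n then 1 else 0) else 0)
          - (∑ n ∈ Icc N₀ x, W n) * (if ∏ i, (d i : ℝ) ≤ y then
              w d * ((((range (∏ i, d i)).filter (P d)).card : ℝ) / ∏ i, (d i : ℝ)) else 0))|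
      ≤ ∑ d ∈ Fintype.piFinset (fun _ : Fin k => Icc 1 ⌊y⌋₊),
        |(if ∏ i, (d i : ℝ) ≤ y then w d * ∑ n ∈ Icc N₀ x, W n * (if P d n then 1 else 0) else 0)
          - (∑ n ∈ Icc N₀ x, W n) * (if ∏ i, (d i : ℝ) ≤ y then
              w d * ((((range (∏ i, d i)).filter (P d)).card : ℝ) / ∏ i, (d i : ℝ)) else 0)| :=
        Finset.abs_sum_le_sum_abs _ _
    _ ≤ ∑ d ∈ Fintype.piFinset (fun _ : Fin k => Icc 1 ⌊y⌋₊), 4 * W x *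
        (if ∏ i, (d i : ℝ) ≤ y then |w d| * (((range (∏ i, d i)).filter (P d)).card : ℝ) else 0) := by
        refine Finset.sum_le_sum fun d hd => ?_
        have hd1 : ∀ i, 1 ≤ d i := fun i => (mem_Icc.mp (Fintype.mem_piFinset.mp hd i)).1
        have hD : 0 < ∏ i, d i := Finset.prod_pos fun i _ => hd1 i
        split_ifs with hp
        · have hper : ∀ n, (fun n => if P d n then (1 : ℝ) else 0) (n + ∏ i, d i)
              = (fun n => if P d n then (1 : ℝ) else 0) n := by
            intro n
            by_cases hn : P d n
            · simp only [if_pos hn, if_pos ((hP d n).mpr hn)]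
            · simp only [if_neg hn, if_neg (fun h => hn ((hP d n).mp h))]
          have hc0 : ∀ n, 0 ≤ (fun n => if P d n then (1 : ℝ) else 0) n := by
            intro n
            by_cases hn : P d n
            · simp only [if_pos hn]; norm_num
            · simp only [if_neg hn]; norm_num
          have key := stub_periodic_weight_Icc W (fun n => if P d n then (1 : ℝ) else 0) N₀ x hN₀x hW0
            hWmono _ hD hper hc0
          rw [← Finset.natCast_card_filter, Nat.cast_prod] at key
          have h : w d * ∑ n ∈ Icc N₀ x, W n * (if P d n then 1 else 0)
              - (∑ n ∈ Icc N₀ x, W n) *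
                (w d * ((((range (∏ i, d i)).filter (P d)).card : ℝ) / ∏ i, (d i : ℝ)))
              = w d * (∑ n ∈ Icc N₀ x, W n * (if P d n then 1 else 0)
                - (((range (∏ i, d i)).filter (P d)).card : ℝ) / (∏ i, (d i : ℝ))
                  * ∑ n ∈ Icc N₀ x, W n) := by ring
          rw [h, abs_mul]
          calc |w d| * |∑ n ∈ Icc N₀ x, W n * (if P d n then 1 else 0)
                - (((range (∏ i, d i)).filter (P d)).card : ℝ) / (∏ i, (d i : ℝ))
                  * ∑ n ∈ Icc N₀ x, W n|
              ≤ |w d| * (4 * (((range (∏ i, d i)).filter (P d)).card : ℝ) * W x) :=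
                mul_le_mul_of_nonneg_left key (abs_nonneg _)
            _ = 4 * W x * (|w d| * (((range (∏ i, d i)).filter (P d)).card : ℝ)) := by ring
        · simp
    _ = 4 * W x * ∑ d ∈ Fintype.piFinset (fun _ : Fin k => Icc 1 ⌊y⌋₊),
        (if ∏ i, (d i : ℝ) ≤ y then |w d| * (((range (∏ i, d i)).filter (P d)).card : ℝ) else 0) := by
        rw [← Finset.mul_sum]

/-! ### The asymptotic model -/

/-- `B + C₃ · t/log t + C₄ · (log t)^m t^θ = o(t)` as `t → ∞` (real variable), for `θ < 1`. [folklore] -/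
theorem isLittleO_model_real (B C₃ C₄ : ℝ) (m : ℕ) {θ : ℝ} (hθ : θ < 1) :
    (fun t : ℝ => B + C₃ * (t / Real.log t) + C₄ * (Real.log t ^ m * t ^ θ))
      =o[atTop] (fun t : ℝ => t) := by
  refine IsLittleO.add (IsLittleO.add ?_ ?_) ?_
  · exact isLittleO_const_id_atTop B
  · refine IsLittleO.const_mul_left ?_ C₃
    have h1 : (fun t : ℝ => (Real.log t)⁻¹) =o[atTop] (fun _ => (1 : ℝ)) :=
      (isLittleO_one_iff ℝ).mpr Real.tendsto_log_atTop.inv_tendsto_atTop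
    have h2 : (fun t : ℝ => t) =O[atTop] (fun t : ℝ => t) := isBigO_refl _ _
    refine (h2.mul_isLittleO h1).congr' ?_ ?_
    · exact Eventually.of_forall fun t => by simp [div_eq_mul_inv]
    · exact Eventually.of_forall fun t => by simp
  · refine IsLittleO.const_mul_left ?_ C₄
    have h1 : (fun t : ℝ => Real.log t ^ m) =o[atTop] (fun t : ℝ => t ^ (1 - θ)) := by
      have h := isLittleO_log_rpow_rpow_atTop (m : ℝ) (by linarith : 0 < 1 - θ)
      exact h.congr_left fun t => by rw [Real.rpow_natCast]
    have h2 : (fun t : ℝ => t ^ θ) =O[atTop] (fun t : ℝ => t ^ θ) := isBigO_refl _ _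
    refine (h1.mul_isBigO h2).congr' EventuallyEq.rfl ?_
    filter_upwards [eventually_gt_atTop 0] with t ht
    rw [← Real.rpow_add ht, sub_add_cancel, Real.rpow_one]

/-- `B + C₃ · x/log x + C₄ · (log x)^m x^θ = o(x)` along `ℕ`, for `θ < 1`. [folklore] -/
theorem isLittleO_model (B C₃ C₄ : ℝ) (m : ℕ) {θ : ℝ} (hθ : θ < 1) :
    (fun x : ℕ => B + C₃ * ((x : ℝ) / Real.log x) + C₄ * (Real.log x ^ m * (x : ℝ) ^ θ))
      =o[atTop] (fun x : ℕ => (x : ℝ)) :=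
  (isLittleO_model_real B C₃ C₄ m hθ).comp_tendsto tendsto_natCast_atTop_atTop

end Summit.Parity.BatemanHorn.Theorems.PolyMobiusTail.NaturalForm.SignedTypeIAux
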